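import Summits.Schanuel.Schanuel.Theses.RoyCriterion
import Literature.NumberTheory.Transcendental.BWMain
import Literature.Barriers.Schanuel.NesterenkoModularScopeConjectureProofs
import Literature.Barriers.Schanuel.LargeTranscendenceDegree

-- `Summit.Schanuel.Schanuel.…` is the mandated layout of this single-problem summit (CONVENTIONS §1).
set_option linter.dupNamespace false

/-!
# Route `RoyCriterion`, crux `SchanuelTwo` (stmt-Schanuel-0069), line `CardA_BW` — stub
# `stub_logRichSector`: the Brownawell–Waldschmidt log-rich sector

The crux `Summit.Schanuel.Schanuel.Theses.RoyCriterion.SchanuelTwo` is Schanuel's conjecture for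
`n = 2`: for `x : Fin 2 → ℂ` linearly independent over `ℚ`, `2 ≤ trdeg_ℚ K_x` where
`K_x = ℚ(x, e^x) = IntermediateField.adjoin ℚ (range x ∪ range (exp ∘ x))`. Line `CardA_BW`
(idea card `Cruxes/SchanuelTwo/Ideas/bw-log-rich-planes.md` + `CardA_BW.lean`, crux-ideate r2,
ideator 5) is a SECTOR ATLAS for the crux; this file lands its LOG-RICH sector, the registered stub
`stub_logRichSector` of the lead's skeleton `Cruxes/SchanuelTwo/Lines/CardA_BW.lean`:

> if there are two `ℚ`-linearly independent logarithms of algebraic numbers `l₁, l₂`, and a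
> multiplier `μ` with `(1, μ)` `ℚ`-linearly independent, such that `l₁, l₂, μ, e^{μ l₁}, e^{μ l₂}`
> are all ALGEBRAIC OVER `K_x`, then `2 ≤ trdeg_ℚ K_x`.

Engine (PROVED in tree, `Literature/NumberTheory/Transcendental/BWMain.lean`): the
Brownawell–Waldschmidt theorem `BrownawellWaldschmidt.brownawell_waldschmidt` (Brownawell 1974,
Waldschmidt 1973; Baker 1975, Ch. 12, Theorem 12.2) applied to the grid `X = (1, μ)`,
`Y = (l₁, l₂)`: `e^{X₀Y₀} = e^{l₁}` and `e^{X₀Y₁} = e^{l₂}` are algebraic, so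
`2 ≤ trdeg ℚ(X, Y, e^{XᵢYⱼ})`; that field sits inside
`K_x(l₁, l₂, μ, e^{l₁}, e^{l₂}, e^{μl₁}, e^{μl₂})`, an ALGEBRAIC extension of `K_x`, so the seven
auxiliary numbers are adjoined at no cost in transcendence degree
(`Literature.Barriers.Schanuel.trdeg_adjoin_union_eq_of_isAlgebraic_adjoin`) and monotonicity
(`trdeg_le_of_injective` along `IntermediateField.inclusion`) finishes.

Contents (sorry-free, no definitions, axioms `propext`/`Classical.choice`/`Quot.sound`; every
"Schanuel field" is written out as `IntermediateField.adjoin ℚ (range x ∪ range (exp ∘ x))`):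
§1 `two_le_trdeg_of_bwConfig` — a B–W configuration INSIDE a subfield `L ⊆ ℂ` forces
`2 ≤ trdeg_ℚ L`; §2 `stub_logRichSector` — the registered stub, verbatim; §3 the flagship
unconditional instance of the crux: `SchanuelTwo` HOLDS at `x = (iπ, −π²/log 2)`
(`two_le_trdeg_SF_piI_negPiSq_div_logTwo`, the pair being `ℚ`-free by
`linearIndependent_piI_negPiSq_div_logTwo`) — `log 2 = (iπ)²/x₁ ∈ K_x` for free, `μ = iπ/log 2`,
`μ · log 2 = iπ`, `μ · iπ = x₁`; equivalently at least two of `π, log 2, e^{π²/log 2}` are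
algebraically independent; §4 the two general `L`-seed families: for every `l` with `e^l ∈ ℚ̄` and
every `la` with `e^{la} ∈ ℚ̄`, `ℚ`-independent of `l`, `SchanuelTwo` holds at `(l, l²/la)`
(`two_le_trdeg_SF_seed_sq_div_log`) and at `(l, la²/l)` (`two_le_trdeg_SF_seed_log_sq_div`).
The sector's complement is NOT claimed easier (card A).
-/

noncomputable section

open Complex IntermediateField
open Literature.Barriers.Schanuel (trdeg_adjoin_union_eq_of_isAlgebraic_adjoin)

namespace Summit.Schanuel.Schanuel.Theorems

/-! ### §1 The Brownawell–Waldschmidt configuration inside a field -/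

/-- **B–W configuration inside a field.** If an intermediate field `L` of `ℂ/ℚ` contains two
`ℚ`-linearly independent logarithms of algebraic numbers `l₁, l₂` (i.e. `e^{l₁}, e^{l₂} ∈ ℚ̄`), a
multiplier `μ` with `(1, μ)` `ℚ`-linearly independent, and the numbers
`e^{l₁}, e^{l₂}, e^{μ l₁}, e^{μ l₂}`, then `2 ≤ trdeg_ℚ L`. Proof: the Brownawell–Waldschmidt
theorem (`Literature.NumberTheory.Transcendental.BrownawellWaldschmidt.brownawell_waldschmidt`)
for the grid `X = (1, μ)`, `Y = (l₁, l₂)` gives `2 ≤ trdeg ℚ(X, Y, e^{XᵢYⱼ})`, and that field is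
contained in `L` (monotonicity of `trdeg` along `IntermediateField.inclusion`).
[cite: BakerTNT1975, Ch. 12 Theorem 12.2] -/
theorem two_le_trdeg_of_bwConfig (L : IntermediateField ℚ ℂ) (l₁ l₂ μ : ℂ)
    (h1 : l₁ ∈ L) (h2 : l₂ ∈ L) (hμ : μ ∈ L)
    (he1 : cexp l₁ ∈ L) (he2 : cexp l₂ ∈ L)
    (ha1 : IsAlgebraic ℚ (cexp l₁)) (ha2 : IsAlgebraic ℚ (cexp l₂))
    (hli : LinearIndependent ℚ ![l₁, l₂]) (hirr : LinearIndependent ℚ ![(1 : ℂ), μ])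
    (hm1 : cexp (μ * l₁) ∈ L) (hm2 : cexp (μ * l₂) ∈ L) :
    (2 : Cardinal) ≤ Algebra.trdeg ℚ L := by
  have hBW :=
    Literature.NumberTheory.Transcendental.BrownawellWaldschmidt.brownawell_waldschmidt
      ![(1 : ℂ), μ] ![l₁, l₂] hirr hli (by simpa using ha1) (by simpa using ha2)
  refine hBW.trans (trdeg_le_of_injective (IntermediateField.inclusion (?_ : _ ≤ L))
    (IntermediateField.inclusion_injective _))
  rw [adjoin_le_iff]
  rintro z ((⟨i, rfl⟩ | ⟨i, rfl⟩) | ⟨⟨i, j⟩, rfl⟩)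
  · fin_cases i
    · simp
    · simpa using hμ
  · fin_cases i
    · simpa using h1
    · simpa using h2
  · fin_cases i <;> fin_cases j
    · simpa using he1
    · simpa using he2
    · simpa using hm1
    · simpa using hm2

/-! ### §2 The registered stub: the log-rich sector -/

/-- **Stub `stub_logRichSector` of line `CardA_BW` (crux `SchanuelTwo`, stmt-Schanuel-0069): the
log-rich sector.** For any pair `x : Fin 2 → ℂ`, if there are two `ℚ`-linearly independent
logarithms of algebraic numbers `l₁, l₂` and a multiplier `μ` with `(1, μ)` `ℚ`-linearly
independent such that `l₁, l₂, μ, e^{μ l₁}, e^{μ l₂}` are all algebraic over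
`K_x = ℚ(x, e^x)`, then `2 ≤ trdeg_ℚ K_x`. Proof: adjoin the seven auxiliary numbers
`l₁, l₂, μ, e^{l₁}, e^{l₂}, e^{μl₁}, e^{μl₂}` to `K_x`; they are algebraic over `K_x`, so the
transcendence degree does not change
(`Literature.Barriers.Schanuel.trdeg_adjoin_union_eq_of_isAlgebraic_adjoin`), and in the enlarged
field the B–W configuration lemma `two_le_trdeg_of_bwConfig` applies.
[cite: BakerTNT1975, Ch. 12 Theorem 12.2] -/
theorem stub_logRichSector :
    ∀ (x : Fin 2 → ℂ) (l₁ l₂ μ : ℂ), IsAlgebraic ℚ (Complex.exp l₁) → IsAlgebraic ℚ (Complex.exp l₂) →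
      LinearIndependent ℚ ![l₁, l₂] → LinearIndependent ℚ ![(1 : ℂ), μ] →
      IsAlgebraic ↥(IntermediateField.adjoin ℚ (Set.range x ∪ Set.range (Complex.exp ∘ x))) l₁ →
      IsAlgebraic ↥(IntermediateField.adjoin ℚ (Set.range x ∪ Set.range (Complex.exp ∘ x))) l₂ →
      IsAlgebraic ↥(IntermediateField.adjoin ℚ (Set.range x ∪ Set.range (Complex.exp ∘ x))) μ →
      IsAlgebraic ↥(IntermediateField.adjoin ℚ (Set.range x ∪ Set.range (Complex.exp ∘ x)))
        (Complex.exp (μ * l₁)) →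
      IsAlgebraic ↥(IntermediateField.adjoin ℚ (Set.range x ∪ Set.range (Complex.exp ∘ x)))
        (Complex.exp (μ * l₂)) →
      (2 : Cardinal) ≤ Algebra.trdeg ℚ
        ↥(IntermediateField.adjoin ℚ (Set.range x ∪ Set.range (Complex.exp ∘ x))) := by
  intro x l₁ l₂ μ ha1 ha2 hli hirr hl1 hl2 hμ hm1 hm2
  set S : Set ℂ := Set.range x ∪ Set.range (Complex.exp ∘ x) with hS
  set T : Set ℂ := {l₁, l₂, μ, cexp l₁, cexp l₂, cexp (μ * l₁), cexp (μ * l₂)} with hT_def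
  have hT : ∀ y ∈ T, IsAlgebraic (adjoin ℚ S) y := by
    intro y hy
    simp only [hT_def, Set.mem_insert_iff, Set.mem_singleton_iff] at hy
    rcases hy with rfl | rfl | rfl | rfl | rfl | rfl | rfl
    exacts [hl1, hl2, hμ, ha1.tower_top _, ha2.tower_top _, hm1, hm2]
  set L : IntermediateField ℚ ℂ := adjoin ℚ (S ∪ T) with hL
  have hsub : S ∪ T ⊆ (L : Set ℂ) := subset_adjoin ℚ _
  have m1 : l₁ ∈ L := hsub (Or.inr (by simp [hT_def]))
  have m2 : l₂ ∈ L := hsub (Or.inr (by simp [hT_def]))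
  have m3 : μ ∈ L := hsub (Or.inr (by simp [hT_def]))
  have m4 : cexp l₁ ∈ L := hsub (Or.inr (by simp [hT_def]))
  have m5 : cexp l₂ ∈ L := hsub (Or.inr (by simp [hT_def]))
  have m6 : cexp (μ * l₁) ∈ L := hsub (Or.inr (by simp [hT_def]))
  have m7 : cexp (μ * l₂) ∈ L := hsub (Or.inr (by simp [hT_def]))
  have h2L : (2 : Cardinal) ≤ Algebra.trdeg ℚ L :=
    two_le_trdeg_of_bwConfig L l₁ l₂ μ m1 m2 m3 m4 m5 ha1 ha2 hli hirr m6 m7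
  calc (2 : Cardinal) ≤ Algebra.trdeg ℚ L := h2L
    _ = Algebra.trdeg ℚ (adjoin ℚ S) := trdeg_adjoin_union_eq_of_isAlgebraic_adjoin S T hT

/-! ### §3 The flagship instance: `SchanuelTwo` holds at `x = (iπ, −π²/log 2)` -/

/-- `(1, πi / log 2)` is `ℚ`-linearly independent (compare real and imaginary parts; `π ≠ 0`,
`log 2 ≠ 0`). [folklore] -/
theorem linearIndependent_one_piI_div_log_two :
    LinearIndependent ℚ ![(1 : ℂ), (Real.pi : ℂ) * I / (Real.log 2 : ℂ)] := by
  have hlog : Real.log 2 ≠ 0 := (Real.log_pos one_lt_two).ne'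
  rw [LinearIndependent.pair_iff]
  intro s t hst
  have hdiv : (Real.pi : ℂ) * I / (Real.log 2 : ℂ) = ((Real.pi / Real.log 2 : ℝ) : ℂ) * I := by
    push_cast
    ring
  rw [hdiv] at hst
  have hre := congrArg Complex.re hst
  have him := congrArg Complex.im hst
  simp only [Complex.add_re, Complex.add_im, Complex.smul_re, Complex.smul_im, Complex.mul_re,
    Complex.mul_im, Complex.ofReal_re, Complex.ofReal_im, Complex.I_re, Complex.I_im,
    Complex.one_re, Complex.one_im, Complex.zero_re, Complex.zero_im, mul_zero, mul_one,
    sub_zero, add_zero, zero_add, smul_zero] at hre him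
  constructor
  · rw [Rat.smul_def, mul_one] at hre
    exact_mod_cast hre
  · rw [Rat.smul_def, mul_eq_zero] at him
    rcases him with h | h
    exacts [by exact_mod_cast h, absurd h (div_ne_zero Real.pi_ne_zero hlog)]

/-- `(log 2, πi)` is `ℚ`-linearly independent (compare real and imaginary parts). [folklore] -/
theorem linearIndependent_logTwo_piI :
    LinearIndependent ℚ ![(Real.log 2 : ℂ), (Real.pi : ℂ) * I] := by
  have hlog : Real.log 2 ≠ 0 := (Real.log_pos one_lt_two).ne'
  rw [LinearIndependent.pair_iff]
  intro s t hst
  have hre := congrArg Complex.re hst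
  have him := congrArg Complex.im hst
  simp only [Complex.add_re, Complex.add_im, Complex.smul_re, Complex.smul_im, Complex.mul_re,
    Complex.mul_im, Complex.ofReal_re, Complex.ofReal_im, Complex.I_re, Complex.I_im,
    Complex.zero_re, Complex.zero_im, mul_zero, mul_one,
    sub_zero, add_zero, zero_add, smul_zero] at hre him
  constructor
  · rw [Rat.smul_def, mul_eq_zero] at hre
    rcases hre with h | h
    exacts [by exact_mod_cast h, absurd h hlog]
  · rw [Rat.smul_def, mul_eq_zero] at him
    rcases him with h | h
    exacts [by exact_mod_cast h, absurd h Real.pi_ne_zero]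

/-- **The pair `(iπ, −π²/log 2)` is `ℚ`-linearly independent** (imaginary vs real coordinate), so
the flagship below is a genuine instance of the crux `SchanuelTwo`. [folklore] -/
theorem linearIndependent_piI_negPiSq_div_logTwo :
    LinearIndependent ℚ ![(Real.pi : ℂ) * I, -((Real.pi : ℂ) ^ 2) / (Real.log 2 : ℂ)] := by
  have hlog : Real.log 2 ≠ 0 := (Real.log_pos one_lt_two).ne'
  have hq : -Real.pi ^ 2 / Real.log 2 ≠ 0 :=
    div_ne_zero (neg_ne_zero.mpr (pow_ne_zero 2 Real.pi_ne_zero)) hlog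
  rw [LinearIndependent.pair_iff]
  intro s t hst
  have hcast : -((Real.pi : ℂ) ^ 2) / (Real.log 2 : ℂ) = ((-Real.pi ^ 2 / Real.log 2 : ℝ) : ℂ) := by
    push_cast
    ring
  rw [hcast] at hst
  have hre := congrArg Complex.re hst
  have him := congrArg Complex.im hst
  simp only [Complex.add_re, Complex.add_im, Complex.smul_re, Complex.smul_im, Complex.mul_re,
    Complex.mul_im, Complex.ofReal_re, Complex.ofReal_im, Complex.I_re, Complex.I_im,
    Complex.zero_re, Complex.zero_im, mul_zero, mul_one,
    sub_zero, add_zero, zero_add, smul_zero] at hre him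
  constructor
  · rw [Rat.smul_def, mul_eq_zero] at him
    rcases him with h | h
    exacts [by exact_mod_cast h, absurd h Real.pi_ne_zero]
  · rw [Rat.smul_def, mul_eq_zero] at hre
    rcases hre with h | h
    exacts [by exact_mod_cast h, absurd h hq]

/-- **`SchanuelTwo` holds at `x = (iπ, −π²/log 2)`** (an unconditional instance of the crux on a
plane through the transcendental seed `iπ` that is neither algebraic nor through `π`, `π√3`):
`2 ≤ trdeg_ℚ ℚ(iπ, −π²/log 2, e^{iπ}, e^{−π²/log 2})`, i.e. at least two of
`π, log 2, e^{π²/log 2}` are algebraically independent. The B–W configuration `l₁ = log 2`,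
`l₂ = iπ`, `μ = iπ/log 2` is realised inside `K_x = ℚ(x, e^x)`, which contains
`log 2 = (iπ)²/x₁` for free; `μ · log 2 = iπ` (`e^{iπ} = -1`), `μ · iπ = x₁`.
[cite: BakerTNT1975, Ch. 12 Theorem 12.2] -/
theorem two_le_trdeg_SF_piI_negPiSq_div_logTwo :
    (2 : Cardinal) ≤ Algebra.trdeg ℚ
      ↥(IntermediateField.adjoin ℚ
        (Set.range ![(Real.pi : ℂ) * I, -((Real.pi : ℂ) ^ 2) / (Real.log 2 : ℂ)] ∪
          Set.range
            (Complex.exp ∘ ![(Real.pi : ℂ) * I, -((Real.pi : ℂ) ^ 2) / (Real.log 2 : ℂ)]))) := by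
  have hlog : (Real.log 2 : ℂ) ≠ 0 := by exact_mod_cast (Real.log_pos one_lt_two).ne'
  have hpi : (Real.pi : ℂ) ≠ 0 := by exact_mod_cast Real.pi_ne_zero
  set x : Fin 2 → ℂ := ![(Real.pi : ℂ) * I, -((Real.pi : ℂ) ^ 2) / (Real.log 2 : ℂ)] with hxdef
  set K : IntermediateField ℚ ℂ := adjoin ℚ (Set.range x ∪ Set.range (Complex.exp ∘ x)) with hKdef
  have hsub : Set.range x ∪ Set.range (Complex.exp ∘ x) ⊆ (K : Set ℂ) := subset_adjoin ℚ _
  have hx0 : (Real.pi : ℂ) * I ∈ K := hsub (Or.inl ⟨0, by simp [hxdef]⟩)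
  have hx1 : -((Real.pi : ℂ) ^ 2) / (Real.log 2 : ℂ) ∈ K := hsub (Or.inl ⟨1, by simp [hxdef]⟩)
  have he1 : cexp (-((Real.pi : ℂ) ^ 2) / (Real.log 2 : ℂ)) ∈ K :=
    hsub (Or.inr ⟨1, by simp [hxdef]⟩)
  -- log 2 ∈ K, for free: log 2 = (iπ)² / x₁
  have hI2 : ((Real.pi : ℂ) * I) ^ 2 = -((Real.pi : ℂ) ^ 2) := by rw [mul_pow, Complex.I_sq]; ring
  have hlog2 : (Real.log 2 : ℂ) ∈ K := by
    have hrepr : (Real.log 2 : ℂ) =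
        ((Real.pi : ℂ) * I) ^ 2 / (-((Real.pi : ℂ) ^ 2) / (Real.log 2 : ℂ)) := by
      rw [hI2]
      have hnum : -((Real.pi : ℂ) ^ 2) ≠ 0 := neg_ne_zero.mpr (pow_ne_zero 2 hpi)
      field_simp
    rw [hrepr]
    exact div_mem (pow_mem hx0 2) hx1
  -- the multiplier μ = iπ / log 2 ∈ K
  have hμ : (Real.pi : ℂ) * I / (Real.log 2 : ℂ) ∈ K := div_mem hx0 hlog2
  refine two_le_trdeg_of_bwConfig K (Real.log 2 : ℂ) ((Real.pi : ℂ) * I)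
    ((Real.pi : ℂ) * I / (Real.log 2 : ℂ)) hlog2 hx0 hμ ?_ ?_ ?_ ?_
    linearIndependent_logTwo_piI linearIndependent_one_piI_div_log_two ?_ ?_
  · -- e^{log 2} = 2 ∈ K
    rw [← Complex.ofReal_exp, Real.exp_log two_pos]
    exact ofNat_mem _ 2
  · -- e^{iπ} = -1 ∈ K
    rw [Complex.exp_pi_mul_I]
    exact neg_mem (one_mem _)
  · rw [← Complex.ofReal_exp, Real.exp_log two_pos]
    simpa using isAlgebraic_algebraMap (R := ℚ) (A := ℂ) 2
  · rw [Complex.exp_pi_mul_I]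
    simpa using isAlgebraic_algebraMap (R := ℚ) (A := ℂ) (-1)
  · -- e^{μ log 2} = e^{iπ} = -1 ∈ K
    rw [div_mul_cancel₀ _ hlog, Complex.exp_pi_mul_I]
    exact neg_mem (one_mem _)
  · -- e^{μ iπ} = e^{x₁} ∈ K
    have hprod : (Real.pi : ℂ) * I / (Real.log 2 : ℂ) * ((Real.pi : ℂ) * I) =
        -((Real.pi : ℂ) ^ 2) / (Real.log 2 : ℂ) := by
      rw [div_mul_eq_mul_div, ← sq, hI2]
    rw [hprod]
    exact he1

/-- The flagship stated as the crux's conclusion at this `ℚ`-linearly independent pair: an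
unconditional instance of `SchanuelTwo` at `x = (iπ, −π²/log 2)` (hypothesis and conclusion of the
crux, both proved). [folklore] -/
theorem schanuelTwo_at_piI_negPiSq_div_logTwo :
    LinearIndependent ℚ ![(Real.pi : ℂ) * I, -((Real.pi : ℂ) ^ 2) / (Real.log 2 : ℂ)] ∧
    (2 : Cardinal) ≤ Algebra.trdeg ℚ
      ↥(IntermediateField.adjoin ℚ
        (Set.range ![(Real.pi : ℂ) * I, -((Real.pi : ℂ) ^ 2) / (Real.log 2 : ℂ)] ∪
          Set.range
            (Complex.exp ∘ ![(Real.pi : ℂ) * I, -((Real.pi : ℂ) ^ 2) / (Real.log 2 : ℂ)]))) :=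
  ⟨linearIndependent_piI_negPiSq_div_logTwo, two_le_trdeg_SF_piI_negPiSq_div_logTwo⟩

/-! ### §4 The two general `L`-seed families -/

/-- `(1, l/la)` is `ℚ`-linearly independent when `(l, la)` is and `la ≠ 0` (swap the pair with
Mathlib's `LinearIndependent.pair_symm_iff` and multiply a vanishing combination by `la`).
[folklore] -/
theorem linearIndependent_one_div {l la : ℂ} (h : LinearIndependent ℚ ![l, la]) (hla : la ≠ 0) :
    LinearIndependent ℚ ![(1 : ℂ), l / la] := by
  have h' := LinearIndependent.pair_symm_iff.1 h
  rw [LinearIndependent.pair_iff] at h' ⊢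
  intro s t hst
  apply h' s t
  have key : (s • la + t • l : ℂ) = (s • (1 : ℂ) + t • (l / la)) * la := by
    simp only [Rat.smul_def]
    field_simp
  rw [key, hst, zero_mul]

/-- **First `L`-seed family: `SchanuelTwo` holds at `x = (l, l²/la)`** for every `l` with `e^l`
algebraic and every logarithm `la` of an algebraic number that is `ℚ`-linearly independent of `l`:
`2 ≤ trdeg_ℚ ℚ(x, e^x)`. Configuration: `la = l²/x₁ ∈ K_x`, `μ = l/la`, `μ · la = l`, `μ · l = x₁`;
the algebraic number `e^{la}` is adjoined to `K_x` at no cost in transcendence degree.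
[cite: BakerTNT1975, Ch. 12 Theorem 12.2] -/
theorem two_le_trdeg_SF_seed_sq_div_log (l la : ℂ) (hl : IsAlgebraic ℚ (cexp l))
    (hla : IsAlgebraic ℚ (cexp la)) (hli : LinearIndependent ℚ ![l, la]) :
    (2 : Cardinal) ≤ Algebra.trdeg ℚ
      ↥(IntermediateField.adjoin ℚ
        (Set.range ![l, l ^ 2 / la] ∪ Set.range (Complex.exp ∘ ![l, l ^ 2 / la]))) := by
  have hl0 : l ≠ 0 := by simpa using hli.ne_zero 0
  have hla0 : la ≠ 0 := by simpa using hli.ne_zero 1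
  set S : Set ℂ := Set.range ![l, l ^ 2 / la] ∪ Set.range (cexp ∘ ![l, l ^ 2 / la]) with hS
  set T : Set ℂ := {cexp la} with hT_def
  have hT : ∀ x ∈ T, IsAlgebraic (adjoin ℚ S) x := by
    intro x hx
    simp only [hT_def, Set.mem_singleton_iff] at hx
    subst hx
    exact hla.tower_top _
  set L : IntermediateField ℚ ℂ := adjoin ℚ (S ∪ T) with hL
  have hsub : S ∪ T ⊆ (L : Set ℂ) := subset_adjoin ℚ _
  have hlm : l ∈ L := hsub (Or.inl (Or.inl ⟨0, by simp⟩))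
  have hx2 : l ^ 2 / la ∈ L := hsub (Or.inl (Or.inl ⟨1, by simp⟩))
  have hel : cexp l ∈ L := hsub (Or.inl (Or.inr ⟨0, by simp⟩))
  have hex2 : cexp (l ^ 2 / la) ∈ L := hsub (Or.inl (Or.inr ⟨1, by simp⟩))
  have hela : cexp la ∈ L := hsub (Or.inr (by simp [hT_def]))
  have hlam : la ∈ L := by
    have : la = l ^ 2 / (l ^ 2 / la) := by field_simp
    rw [this]
    exact div_mem (pow_mem hlm 2) hx2
  have hμ : l / la ∈ L := div_mem hlm hlam
  have h2L : (2 : Cardinal) ≤ Algebra.trdeg ℚ L := by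
    refine two_le_trdeg_of_bwConfig L la l (l / la) hlam hlm hμ hela hel hla hl
      (LinearIndependent.pair_symm_iff.1 hli) (linearIndependent_one_div hli hla0) ?_ ?_
    · have : l / la * la = l := by field_simp
      rw [this]; exact hel
    · have : l / la * l = l ^ 2 / la := by rw [div_mul_eq_mul_div, ← sq]
      rw [this]; exact hex2
  calc (2 : Cardinal) ≤ Algebra.trdeg ℚ L := h2L
    _ = Algebra.trdeg ℚ (adjoin ℚ S) := trdeg_adjoin_union_eq_of_isAlgebraic_adjoin S T hT

/-- **Second `L`-seed family: `SchanuelTwo` holds at `x = (l, la²/l)`** for every `l` with `e^l`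
algebraic and every logarithm `la` of an algebraic number that is `ℚ`-linearly independent of `l`:
`2 ≤ trdeg_ℚ ℚ(x, e^x)`. Here `la` is a square root of `x₀ x₁ ∈ K_x`, adjoined (with the algebraic
`e^{la}`) at no cost in transcendence degree; `μ = la/l`, `μ · l = la`, `μ · la = x₁`.
[cite: BakerTNT1975, Ch. 12 Theorem 12.2] -/
theorem two_le_trdeg_SF_seed_log_sq_div (l la : ℂ) (hl : IsAlgebraic ℚ (cexp l))
    (hla : IsAlgebraic ℚ (cexp la)) (hli : LinearIndependent ℚ ![l, la]) :
    (2 : Cardinal) ≤ Algebra.trdeg ℚ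
      ↥(IntermediateField.adjoin ℚ
        (Set.range ![l, la ^ 2 / l] ∪ Set.range (Complex.exp ∘ ![l, la ^ 2 / l]))) := by
  have hl0 : l ≠ 0 := by simpa using hli.ne_zero 0
  have hla0 : la ≠ 0 := by simpa using hli.ne_zero 1
  set S : Set ℂ := Set.range ![l, la ^ 2 / l] ∪ Set.range (cexp ∘ ![l, la ^ 2 / l]) with hS
  -- la is algebraic over ℚ(S): la² = l · x₁ ∈ ℚ(S)
  have hlS : l ∈ adjoin ℚ S := subset_adjoin ℚ _ (Or.inl ⟨0, by simp⟩)
  have hx2S : la ^ 2 / l ∈ adjoin ℚ S := subset_adjoin ℚ _ (Or.inl ⟨1, by simp⟩)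
  have hla2S : la ^ 2 ∈ adjoin ℚ S := by
    have : la ^ 2 = l * (la ^ 2 / l) := by field_simp
    rw [this]
    exact mul_mem hlS hx2S
  have hlaAlg : IsAlgebraic (adjoin ℚ S) la :=
    IsAlgebraic.of_pow two_pos (isAlgebraic_algebraMap (⟨la ^ 2, hla2S⟩ : adjoin ℚ S))
  set T : Set ℂ := {la, cexp la} with hT_def
  have hT : ∀ x ∈ T, IsAlgebraic (adjoin ℚ S) x := by
    intro x hx
    simp only [hT_def, Set.mem_insert_iff, Set.mem_singleton_iff] at hx
    rcases hx with rfl | rfl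
    exacts [hlaAlg, hla.tower_top _]
  set L : IntermediateField ℚ ℂ := adjoin ℚ (S ∪ T) with hL
  have hsub : S ∪ T ⊆ (L : Set ℂ) := subset_adjoin ℚ _
  have hlm : l ∈ L := hsub (Or.inl (Or.inl ⟨0, by simp⟩))
  have hex2 : cexp (la ^ 2 / l) ∈ L := hsub (Or.inl (Or.inr ⟨1, by simp⟩))
  have hel : cexp l ∈ L := hsub (Or.inl (Or.inr ⟨0, by simp⟩))
  have hlam : la ∈ L := hsub (Or.inr (by simp [hT_def]))
  have hela : cexp la ∈ L := hsub (Or.inr (by simp [hT_def]))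
  have hμ : la / l ∈ L := div_mem hlam hlm
  have h2L : (2 : Cardinal) ≤ Algebra.trdeg ℚ L := by
    refine two_le_trdeg_of_bwConfig L l la (la / l) hlm hlam hμ hel hela hl hla hli
      (linearIndependent_one_div (LinearIndependent.pair_symm_iff.1 hli) hl0) ?_ ?_
    · have : la / l * l = la := by field_simp
      rw [this]; exact hela
    · have : la / l * la = la ^ 2 / l := by rw [div_mul_eq_mul_div, ← sq]
      rw [this]; exact hex2
  calc (2 : Cardinal) ≤ Algebra.trdeg ℚ L := h2L
    _ = Algebra.trdeg ℚ (adjoin ℚ S) := trdeg_adjoin_union_eq_of_isAlgebraic_adjoin S T hT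

end Summit.Schanuel.Schanuel.Theorems

end
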